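import Mathlib
import Summits.NavierStokesRegularity.NavierStokesRegularity.Theorems.EulerZoomLiouvillePowerGaugeEulerLiouvilleSelfSimilarPressureStrainExcessMember
import Summits.NavierStokesRegularity.NavierStokesRegularity.Theorems.EulerZoomLiouvillePowerGaugeEulerLiouvilleSelfSimilarBernoulliBoundedVortical
import HarnessLib

/-!
# «NOR A VORTEX-DOMINATED FAR FIELD WITH BOUNDED VORTICAL BERNOULLI LEVELS» — a T2 stratum of the crux
# `EulerZoomLiouville.PowerGaugeEulerLiouville` (stmt-NavierStokesRegularity-19832; LEAD ns-typeII-p2 g12 RESIDUE-MEMO §2 T2; width seat ns-ezl-w1 g4)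

Route №10 `EulerZoomLiouville` (NavierStokesRegularity).  THE ONE STATEMENT keeps, in alternative (N2), the needle portrait
`¬HasVorticalBernoulliBound`: `sup_{curl ≠ 0} ℋ = +∞` OR a PRESSURISED vortical far field (`P′(y) > ε‖y‖²` beyond every radius).  By
`PressureParking.exists_strainDominated_near_pressurised_point_member` (p653934: sub-mean-value defect identity + `ΔP′ = |curl V|² − |∇V|²_F`
+ the `D`-gauge's sub-quadratic ball averages) a pressurised far point has a STRAIN-DOMINATED point (`|curl V|² < |∇V|²_F`, the `Q < 0`
region of the `Q`-criterion) within `2((C/κ+1)L^{−1−2ρ})^{1/3} ≤ 2(C/κ+1)^{1/3}`.  Hence a purely KINEMATIC far-field hypothesis on the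
profile — VORTEX DOMINATION `|∇V(z)|²_F ≤ |curl V(z)|²` (`|S|² ≤ ½|ω|²`, `Q ≥ 0`) for `‖z‖ ≥ R₀` — discharges the pressure half of
`HasVorticalBernoulliBound` for EVERY classical pressure and every `ε > 0`, and the LEAD's vortical bounded-Bernoulli stratum
(`Loc.selfSimilar_ae_eq_zero_of_vorticalBoundedBernoulliC2_profile`, p630865) closes:

* `unpressurised_of_vortexDominatedFarField` — vortex-dominated far field ⇒ for every classical pressure `P′` and every `ε > 0`,
  `P′(y) ≤ ε‖y‖²` far out;
* `selfSimilar_ae_eq_zero_of_vortexDominated_boundedVorticalBernoulliC2_profile` — binder shape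
  `InClass → IsExactlySelfSimilar → ContDiff ℝ 2 V → (∀ P′ classical, ∃ Mb, ℋ_{P′} ≤ Mb on {curl V ≠ 0}) →
   (∃ R₀, ∀ z, R₀ ≤ ‖z‖ → |∇V z|²_F ≤ |curl V z|²) → u = 0 a.e.`

READING: the needle's pressurised slow vortical channels need STRAIN-DOMINATED points beyond every radius («nor vortex-dominated far field
with bounded vortical Bernoulli levels»).  HONEST LABEL: thin portrait stratum (the capacity estimate of T2 is untouched).
WHAT THIS IS NOT: not NS, not E — `--supports` stmt-19832; 19832 OPEN; NS regularity NOT proved. [folklore]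
-/

noncomputable section

-- flat `Theorems/<Route><Decl>…` files of one crux share the namespace of the crux (tree convention)
set_option linter.dupNamespace false

open MeasureTheory Set Filter Topology Metric Function InnerProductSpace TopologicalSpace
open scoped RealInnerProductSpace NNReal ENNReal

namespace Summit.NavierStokesRegularity.NavierStokesRegularity.Theorems.PowerGaugeEulerLiouville.PressureParking

open Literature.Analysis Literature.Analysis.FunctionSpaces Literature.Analysis.FluidPDE

/-- **VORTEX-DOMINATED FAR FIELD ⇒ UNPRESSURISED FAR FIELD.**  For an exactly self-similar in-class member with `C²` profile `V` whose far
field is vortex-dominated (`|∇V(z)|²_F ≤ |curl V(z)|²` for `‖z‖ ≥ R₀`), every classical pressure `P′` satisfies `P′(y) ≤ ε‖y‖²` far out,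
for every `ε > 0`: a far point with `P′(y) > ε‖y‖²` would be pressurised (`P′ + c₀ ≥ 3κ‖y‖²`, `κ = ε/6`) and carry a strain-dominated
point within `2(C/κ+1)^{1/3}`, still in the vortex-dominated region — absurd. [folklore] -/
theorem unpressurised_of_vortexDominatedFarField {ρ : ℝ} (hρ : 0 < ρ) (hρ1 : ρ < 1)
    {u : ℝ → EuclideanSpace ℝ (Fin 3) → EuclideanSpace ℝ (Fin 3)} {p : ℝ → EuclideanSpace ℝ (Fin 3) → ℝ}
    {H : ℝ → EuclideanSpace ℝ (Fin 3) → EuclideanSpace ℝ (Fin 3) →L[ℝ] EuclideanSpace ℝ (Fin 3)} {c : ℝ≥0}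
    (hsw : IsSuitableWeakSolutionOn (slab (EuclideanSpace ℝ (Fin 3)) (Iio 0) isOpen_Iio) 0 0 u p)
    (hgauge : ∀ a : ℝ, 0 < a →
      ENNReal.ofReal (a ^ (2 * ρ)) * cknA a (0 : ℝ × EuclideanSpace ℝ (Fin 3)) u +
          ENNReal.ofReal (a ^ ρ) * cknE a (0 : ℝ × EuclideanSpace ℝ (Fin 3)) H +
        ENNReal.ofReal (a ^ (2 * ρ)) * cknD a (0 : ℝ × EuclideanSpace ℝ (Fin 3)) p ≤ (c : ℝ≥0∞))
    {V : EuclideanSpace ℝ (Fin 3) → EuclideanSpace ℝ (Fin 3)} {P : EuclideanSpace ℝ (Fin 3) → ℝ}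
    (hu : ∀ τ : ℝ, τ < 0 → u τ = selfSimilarCollapse (1 / (2 + ρ)) 0 V τ)
    (hp : ∀ τ : ℝ, τ < 0 → p τ = selfSimilarCollapsePressure (1 / (2 + ρ)) 0 P τ)
    (hV : ContDiff ℝ 2 V)
    (hQ : ∃ R₀ : ℝ, ∀ z : EuclideanSpace ℝ (Fin 3), R₀ ≤ ‖z‖ → frobeniusNormSq (fderiv ℝ V z) ≤ ‖curl V z‖ ^ 2)
    {P' : EuclideanSpace ℝ (Fin 3) → ℝ} (hprof : IsSelfSimilarEulerProfile (1 / (2 + ρ)) 0 V P')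
    {ε : ℝ} (hε : 0 < ε) :
    ∃ R₁ : ℝ, ∀ y : EuclideanSpace ℝ (Fin 3), R₁ ≤ ‖y‖ → P' y ≤ ε * ‖y‖ ^ 2 := by
  obtain ⟨R₀, hR₀⟩ := hQ
  have hκ : 0 < ε / 6 := by positivity
  obtain ⟨c₀, L₁, C, hL₁, hC, -, hmain⟩ :=
    exists_strainDominated_near_pressurised_point_member hρ hρ1 hsw hgauge hu hp hV hprof hκ
  set D₀ : ℝ := 2 * (C / (ε / 6) + 1) ^ (1 / 3 : ℝ) with hD₀
  have hD₀0 : 0 ≤ D₀ := by rw [hD₀]; positivity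
  refine ⟨max L₁ (max (R₀ + D₀) (2 * |c₀| / ε + 1)), fun y hy => ?_⟩
  have hyL₁ : L₁ ≤ ‖y‖ := (le_max_left _ _).trans hy
  have hyR : R₀ + D₀ ≤ ‖y‖ := ((le_max_left _ _).trans (le_max_right _ _)).trans hy
  have hyc : 2 * |c₀| / ε + 1 ≤ ‖y‖ := ((le_max_right _ _).trans (le_max_right _ _)).trans hy
  have hy1 : 1 ≤ ‖y‖ := hL₁.trans hyL₁
  by_contra hPy
  rw [not_le] at hPy
  -- `y` is pressurised: `3 (ε/6) ‖y‖² ≤ P′ y + c₀`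
  have hc₀ : |c₀| ≤ ε / 2 * ‖y‖ ^ 2 := by
    have h1 : 2 * |c₀| / ε ≤ ‖y‖ := by linarith
    rw [div_le_iff₀ hε] at h1
    nlinarith [abs_nonneg c₀]
  have hpress : 3 * (ε / 6) * ‖y‖ ^ 2 ≤ P' y + c₀ := by
    have := neg_abs_le c₀
    nlinarith
  obtain ⟨z, hz, hzs⟩ := hmain ‖y‖ hyL₁ y le_rfl hpress
  -- the strain-dominated point is still in the vortex-dominated region
  have hdist : dist z y < D₀ := by
    refine hz.trans_le ?_
    rw [hD₀]
    refine mul_le_mul_of_nonneg_left (Real.rpow_le_rpow (by positivity) ?_ (by norm_num)) zero_le_two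
    have h1 : ‖y‖ ^ (-1 - 2 * ρ) ≤ 1 := Real.rpow_le_one_of_one_le_of_nonpos hy1 (by linarith)
    have h2 : 0 ≤ C / (ε / 6) + 1 := by positivity
    nlinarith
  have hzR : R₀ ≤ ‖z‖ := by
    have := norm_sub_norm_le y z
    rw [← dist_eq_norm, dist_comm] at this
    linarith
  exact absurd (hR₀ z hzR) (not_le.2 hzs)

/-- **«NOR A VORTEX-DOMINATED FAR FIELD WITH BOUNDED VORTICAL BERNOULLI LEVELS»** (T2 stratum, binder shape for `Lines/birth.lean`): in the
window `0 < ρ ≤ ½`, an exactly self-similar in-class member with `C²` profile `V` such that, for every classical pressure, the Bernoulli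
function is bounded above on the vortical set, and whose far field is vortex-dominated (`|∇V|²_F ≤ |curl V|²` beyond some radius), is
trivial: `unpressurised_of_vortexDominatedFarField` + the LEAD's `Loc.selfSimilar_ae_eq_zero_of_vorticalBoundedBernoulliC2_profile`.
[folklore] -/
theorem selfSimilar_ae_eq_zero_of_vortexDominated_boundedVorticalBernoulliC2_profile {ρ : ℝ} (hρ : 0 < ρ) (hρ1 : ρ ≤ 1 / 2)
    {u : ℝ → EuclideanSpace ℝ (Fin 3) → EuclideanSpace ℝ (Fin 3)} {p : ℝ → EuclideanSpace ℝ (Fin 3) → ℝ}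
    {H : ℝ → EuclideanSpace ℝ (Fin 3) → EuclideanSpace ℝ (Fin 3) →L[ℝ] EuclideanSpace ℝ (Fin 3)} {c : ℝ≥0}
    (hsw : IsSuitableWeakSolutionOn (slab (EuclideanSpace ℝ (Fin 3)) (Iio 0) isOpen_Iio) 0 0 u p)
    (hgauge : ∀ a : ℝ, 0 < a →
      ENNReal.ofReal (a ^ (2 * ρ)) * cknA a (0 : ℝ × EuclideanSpace ℝ (Fin 3)) u +
          ENNReal.ofReal (a ^ ρ) * cknE a (0 : ℝ × EuclideanSpace ℝ (Fin 3)) H +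
        ENNReal.ofReal (a ^ (2 * ρ)) * cknD a (0 : ℝ × EuclideanSpace ℝ (Fin 3)) p ≤ (c : ℝ≥0∞))
    {V : EuclideanSpace ℝ (Fin 3) → EuclideanSpace ℝ (Fin 3)} {P : EuclideanSpace ℝ (Fin 3) → ℝ}
    (hu : ∀ τ : ℝ, τ < 0 → u τ = selfSimilarCollapse (1 / (2 + ρ)) 0 V τ)
    (hp : ∀ τ : ℝ, τ < 0 → p τ = selfSimilarCollapsePressure (1 / (2 + ρ)) 0 P τ)
    (hV : ContDiff ℝ 2 V)
    (hB : ∀ P' : EuclideanSpace ℝ (Fin 3) → ℝ, IsSelfSimilarEulerProfile (1 / (2 + ρ)) 0 V P' →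
      ∃ Mb : ℝ, ∀ y, curl V y ≠ 0 → selfSimilarBernoulli (1 / (2 + ρ)) 0 V P' y ≤ Mb)
    (hQ : ∃ R₀ : ℝ, ∀ z : EuclideanSpace ℝ (Fin 3), R₀ ≤ ‖z‖ → frobeniusNormSq (fderiv ℝ V z) ≤ ‖curl V z‖ ^ 2) :
    uncurry u =ᵐ[volume.restrict (Iio (0 : ℝ) ×ˢ (univ : Set (EuclideanSpace ℝ (Fin 3))))] 0 := by
  have hρ1' : ρ < 1 := by linarith
  have hγpos : (0 : ℝ) < (1 / (2 + ρ)) * (1 - 1 / (2 + ρ)) / 2 := by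
    have h2ρ : (0 : ℝ) < 2 + ρ := by linarith
    have hγ1 : 1 / (2 + ρ) < 1 := by rw [div_lt_one h2ρ]; linarith
    have hγ0 : 0 < 1 / (2 + ρ) := by positivity
    have : 0 < 1 - 1 / (2 + ρ) := by linarith
    positivity
  refine Loc.selfSimilar_ae_eq_zero_of_vorticalBoundedBernoulliC2_profile hρ hρ1 hsw hgauge hu hp hV fun P' hprof' => ⟨hB P' hprof', ?_⟩
  set ε : ℝ := (1 / (2 + ρ)) * (1 - 1 / (2 + ρ)) / 4 with hεdef
  have hε : 0 < ε := by rw [hεdef]; linarith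
  obtain ⟨R₁, hR₁⟩ := unpressurised_of_vortexDominatedFarField hρ hρ1' hsw hgauge hu hp hV hQ hprof' hε
  exact ⟨ε, R₁, by rw [hεdef]; linarith, fun y hy _ => hR₁ y hy⟩

end Summit.NavierStokesRegularity.NavierStokesRegularity.Theorems.PowerGaugeEulerLiouville.PressureParking

end
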